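import Mathlib
import HarnessLib
import Summits.NavierStokesRegularity.NavierStokesRegularity.Theorems.PoloidalWindowDoorLrcModEntireQ4CurvedVerticalEntrance

/-!
# Route `PoloidalWindowDoor`, item `LrcModEntire` (stmt-NavierStokesRegularity-20428), cell (Q4-curved), v16 child «VERTICAL» —
# VERT-PROP (7b): ON A VERTICAL CRITICAL CURTAIN THE HORIZONTAL VELOCITY IS HORIZONTALLY HARMONIC AND `z`-FLAT (`ΔₕUₕ = 0`, `∂_z²Uₕ = 0`)

Cell ns-regularity-ideate, helper seat ns-k2-port-2 g9 under the LEAD of item 20428 (ns-poloidal-K2-p3 g18, P3 as redefined 2026-08-30T02:26:25Z: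
`Cruxes/LrcModEntire/VERT-PROP-g18.md` v2 §7 (7b)); `--supports stmt-NavierStokesRegularity-20428 --as helper`.  CLASS LEVEL at the hot time `t = −1`,
in the currency of the V-ENTRANCE (`…Q4CurvedVerticalEntrance.vertical_entrance`): (E1) the cylinder `Γ × ℝ` is horizontally critical for `U₂(−1,·)` and (E3a)
`∂_zU_b(−1) = 0` on it inside the (TH) slab `|z| < ρ` (both taken as hypotheses VERBATIM in the shape (E1)/(E3a) are exported; `Γ` is an arbitrary map here).

★★ `vertical_curtain_lines` — at every curtain point `P = Γ s + z·e₂` with `|z| < ρ`, for `b = 0, 1`: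
`∂₀²U_b(P) + ∂₁²U_b(P) = 0` (HORIZONTALLY HARMONIC) and `∂₂²U_b(P) = 0` (`z`-FLAT), in nested coordinates
(`fderiv (fun y => fderiv (U(−1)) y eᵢ b) P eᵢ`).  Proof (VERT-PROP §7): differentiate the identities that hold EVERYWHERE — `div U = 0` (class) and
`ω₂ = ∂₀U₁ − ∂₁U₀ = 0` (poloidal) — once horizontally, use the symmetry of second derivatives of the `C²` components, and kill the remaining term
`∂_b∂₂U₂(P) = ∂₂(∂_bU₂)(P)`, which vanishes because `∂_bU₂ ≡ 0` along the vertical line through `P` (E1); `∂₂²U_b(P) = ∂₂(∂₂U_b)(P) = 0` because `∂₂U_b ≡ 0`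
along the same line (E3a).  («Curtain lines are pressure-driven: the viscous force on `Uₕ` vanishes on the curtain.»)

WHAT THIS IS NOT: not a claim about Navier–Stokes regularity; closes nothing (kernel brick for the RESEARCH slot `stub_Q4curvedAperiodicVertical`);
items 20428 / 19708 / 27893 OPEN (bears_on LADDER-NS N0).
-/

noncomputable section

set_option linter.dupNamespace false
set_option linter.style.longLine false

namespace Summit.NavierStokesRegularity.NavierStokesRegularity.Theorems.PoloidalWindowDoorLrcModEntireQ4CurvedVerticalCurtainLines

open Set Function Filter Topology Metric
open scoped RealInnerProductSpace InnerProductSpace Laplacian ContDiff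
open Literature.Analysis Literature.Analysis.FluidPDE Literature.Analysis.UnboundedOperators
open Summit.NavierStokesRegularity.NavierStokesRegularity.Theorems
open Summit.NavierStokesRegularity.NavierStokesRegularity.Theorems.LocalSineTubeDoorProfileAlignedWindowRigidityAncient
open Summit.NavierStokesRegularity.NavierStokesRegularity.Theorems.PoloidalWindowDoorPoloidalWindowRigidityConstantShearSlice
open Summit.NavierStokesRegularity.NavierStokesRegularity.Theorems.PoloidalWindowDoorLrcModEntireSheetFlattenTools

variable {C : ℝ} {U : ℝ → EuclideanSpace ℝ (Fin 3) → EuclideanSpace ℝ (Fin 3)}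

/-- ★★ **VERT-PROP (7b): ON A VERTICAL CRITICAL CURTAIN `ΔₕU_b = 0` AND `∂_z²U_b = 0` (`b = 0, 1`).**  See the module docstring. -/
theorem vertical_curtain_lines
    (hrate : HasTypeITimeDecay C U) (hcont : ContinuousOn (uncurry U) (Iio (0 : ℝ) ×ˢ univ))
    (hmild : ∀ s t : ℝ, s < t → t < 0 → ∀ x, U t x = heatExtension (U s) (t - s) x - oseenDuhamel 1 s U U t x)
    (hdiv : ∀ t < 0, VectorCalculus.IsDivFree (U t))
    (hpol : ∀ s < 0, ∀ y, ⟪curl (U s) y, EuclideanSpace.single 2 1⟫_ℝ = 0)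
    {ρ : ℝ} {Γ : ℝ → EuclideanSpace ℝ (Fin 3)}
    (hE1 : ∀ s z : ℝ, ∀ w : EuclideanSpace ℝ (Fin 3), w 2 = 0 → fderiv ℝ (fun y => U (-1) y 2) (Γ s + z • e2) w = 0)
    (hE3 : ∀ s z : ℝ, |z| < ρ → ∀ b : Fin 3, b ≠ 2 → fderiv ℝ (U (-1)) (Γ s + z • e2) (EuclideanSpace.single 2 1) b = 0)
    (s : ℝ) {z : ℝ} (hz : |z| < ρ) {b : Fin 3} (hb : b ≠ 2) :
    fderiv ℝ (fun y => fderiv ℝ (U (-1)) y (EuclideanSpace.single 0 (1 : ℝ)) b) (Γ s + z • e2) (EuclideanSpace.single 0 (1 : ℝ)) +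
        fderiv ℝ (fun y => fderiv ℝ (U (-1)) y (EuclideanSpace.single 1 (1 : ℝ)) b) (Γ s + z • e2) (EuclideanSpace.single 1 (1 : ℝ)) = 0 ∧
      fderiv ℝ (fun y => fderiv ℝ (U (-1)) y (EuclideanSpace.single 2 (1 : ℝ)) b) (Γ s + z • e2) (EuclideanSpace.single 2 (1 : ℝ)) = 0 := by
  have hm1 : (-1 : ℝ) < 0 := by norm_num
  -- smoothness of the slice and of its components
  have hUan : AnalyticOnNhd ℝ (U (-1)) univ := analyticOnNhd_slice hcont (bdd_of_hasTypeITimeDecay hrate) hmild hm1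
  have hUd : Differentiable ℝ (U (-1)) := fun x => (hUan x (mem_univ _)).differentiableAt
  have hθan : ∀ c : Fin 3, AnalyticOnNhd ℝ (fun y => U (-1) y c) univ := fun c x _ =>
    ((EuclideanSpace.proj (𝕜 := ℝ) c).analyticAt _).comp (hUan x (mem_univ _))
  have hθ2 : ∀ c : Fin 3, ContDiff ℝ 2 (fun y => U (-1) y c) := fun c => (hθan c).contDiff
  have hcoord : ∀ (c : Fin 3) (x w : EuclideanSpace ℝ (Fin 3)), fderiv ℝ (fun y => U (-1) y c) x w = fderiv ℝ (U (-1)) x w c := by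
    intro c x w
    have hc := ((EuclideanSpace.proj (𝕜 := ℝ) c).hasFDerivAt.comp x (hUd x).hasFDerivAt).fderiv
    rw [show (fun y => U (-1) y c) = (EuclideanSpace.proj (𝕜 := ℝ) c) ∘ U (-1) from rfl, hc]
    rfl
  -- the nested second partials `D u v c x := ∂_v ∂_u U_c (x)` and their symmetry
  have hDdef : ∀ (u : EuclideanSpace ℝ (Fin 3)) (c : Fin 3),
      (fun y => fderiv ℝ (U (-1)) y u c) = fun y => fderiv ℝ (fun y' => U (-1) y' c) y u := fun u c => by
    funext y; rw [hcoord]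
  have hDd : ∀ (u : EuclideanSpace ℝ (Fin 3)) (c : Fin 3), Differentiable ℝ (fun y => fderiv ℝ (U (-1)) y u c) := by
    intro u c
    rw [hDdef u c]
    exact (((hθ2 c).fderiv_right (m := 1) (by norm_num)).differentiable (by norm_num)).clm_apply (differentiable_const u)
  have hsymm : ∀ (u v : EuclideanSpace ℝ (Fin 3)) (c : Fin 3) (x : EuclideanSpace ℝ (Fin 3)),
      fderiv ℝ (fun y => fderiv ℝ (U (-1)) y u c) x v = fderiv ℝ (fun y => fderiv ℝ (U (-1)) y v c) x u := by
    intro u v c x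
    rw [hDdef u c, hDdef v c, nested_eq_fderiv_fderiv (hθ2 c) x v u, nested_eq_fderiv_fderiv (hθ2 c) x u v]
    exact ((hθ2 c).contDiffAt.isSymmSndFDerivAt (by simp)).eq v u
  -- differentiating an identity `Σ cᵢ ∂_{uᵢ}U_{cᵢ} ≡ const`: generic two- and three-term versions via `HasFDerivAt`
  have hDat : ∀ (u : EuclideanSpace ℝ (Fin 3)) (c : Fin 3) (x : EuclideanSpace ℝ (Fin 3)),
      HasFDerivAt (fun y => fderiv ℝ (U (-1)) y u c) (fderiv ℝ (fun y => fderiv ℝ (U (-1)) y u c) x) x := fun u c x => (hDd u c x).hasFDerivAt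
  set e₀ : EuclideanSpace ℝ (Fin 3) := EuclideanSpace.single 0 (1 : ℝ) with he₀
  set e₁ : EuclideanSpace ℝ (Fin 3) := EuclideanSpace.single 1 (1 : ℝ) with he₁
  set P : EuclideanSpace ℝ (Fin 3) := Γ s + z • e2 with hP
  have he2 : (e2 : EuclideanSpace ℝ (Fin 3)) = EuclideanSpace.single 2 (1 : ℝ) := rfl
  /- (b) `div U ≡ 0` differentiated in the direction `v`: `D e₀ v 0 + D e₁ v 1 + D e₂ v 2 = 0` -/
  have hdivD : ∀ v : EuclideanSpace ℝ (Fin 3),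
      fderiv ℝ (fun y => fderiv ℝ (U (-1)) y e₀ 0) P v + fderiv ℝ (fun y => fderiv ℝ (U (-1)) y e₁ 1) P v +
        fderiv ℝ (fun y => fderiv ℝ (U (-1)) y e2 2) P v = 0 := by
    intro v
    have hsum : HasFDerivAt (fun y => fderiv ℝ (U (-1)) y e₀ 0 + fderiv ℝ (U (-1)) y e₁ 1 + fderiv ℝ (U (-1)) y e2 2)
        (fderiv ℝ (fun y => fderiv ℝ (U (-1)) y e₀ 0) P + fderiv ℝ (fun y => fderiv ℝ (U (-1)) y e₁ 1) P +
          fderiv ℝ (fun y => fderiv ℝ (U (-1)) y e2 2) P) P := ((hDat e₀ 0 P).add (hDat e₁ 1 P)).add (hDat e2 2 P)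
    have hzero : (fun y => fderiv ℝ (U (-1)) y e₀ 0 + fderiv ℝ (U (-1)) y e₁ 1 + fderiv ℝ (U (-1)) y e2 2) = fun _ => (0 : ℝ) := by
      funext y; exact div_coord (hdiv _ hm1) y
    rw [hzero] at hsum
    have h := (hasFDerivAt_const (0 : ℝ) P).unique hsum
    have h' := congrArg (fun L : EuclideanSpace ℝ (Fin 3) →L[ℝ] ℝ => L v) h
    simpa using h'.symm
  /- (c) `ω₂ = ∂₀U₁ − ∂₁U₀ ≡ 0` differentiated in the direction `v`: `D e₀ v 1 = D e₁ v 0` -/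
  have hcurlD : ∀ v : EuclideanSpace ℝ (Fin 3),
      fderiv ℝ (fun y => fderiv ℝ (U (-1)) y e₀ 1) P v = fderiv ℝ (fun y => fderiv ℝ (U (-1)) y e₁ 0) P v := by
    intro v
    have hsub : HasFDerivAt (fun y => fderiv ℝ (U (-1)) y e₀ 1 - fderiv ℝ (U (-1)) y e₁ 0)
        (fderiv ℝ (fun y => fderiv ℝ (U (-1)) y e₀ 1) P - fderiv ℝ (fun y => fderiv ℝ (U (-1)) y e₁ 0) P) P := (hDat e₀ 1 P).sub (hDat e₁ 0 P)
    have hzero : (fun y => fderiv ℝ (U (-1)) y e₀ 1 - fderiv ℝ (U (-1)) y e₁ 0) = fun _ => (0 : ℝ) := by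
      funext y
      have h2 : curl (U (-1)) y 2 = 0 := by simpa [EuclideanSpace.inner_single_right] using hpol (-1) hm1 y
      simpa [curl] using h2
    rw [hzero] at hsub
    have h := (hasFDerivAt_const (0 : ℝ) P).unique hsub
    have h' := congrArg (fun L : EuclideanSpace ℝ (Fin 3) →L[ℝ] ℝ => L v) h
    have h'' : fderiv ℝ (fun y => fderiv ℝ (U (-1)) y e₀ 1) P v - fderiv ℝ (fun y => fderiv ℝ (U (-1)) y e₁ 0) P v = 0 := by
      simpa using h'.symm
    linarith
  /- (d) along the vertical line through `P`: `∂₂(∂_uU₂) = 0` for horizontal `u` (E1) and `∂₂(∂₂U_b) = 0` (E3a) -/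
  have hline : ∀ z' : ℝ, HasDerivAt (fun z'' : ℝ => Γ s + z'' • e2) e2 z' := fun z' => by
    have h := ((hasDerivAt_id' z').smul_const e2).const_add (Γ s); rw [one_smul] at h; exact h
  have hlineD : ∀ (u : EuclideanSpace ℝ (Fin 3)) (c : Fin 3), (∀ᶠ z' in 𝓝 z, fderiv ℝ (U (-1)) (Γ s + z' • e2) u c = 0) →
      fderiv ℝ (fun y => fderiv ℝ (U (-1)) y u c) P e2 = 0 := by
    intro u c hev
    have hc := (hDat u c P).comp_hasDerivAt z (hline z)
    have hev' : (fun z'' : ℝ => fderiv ℝ (U (-1)) (Γ s + z'' • e2) u c) =ᶠ[𝓝 z] fun _ => 0 := hev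
    have h0 : deriv (fun z'' : ℝ => fderiv ℝ (U (-1)) (Γ s + z'' • e2) u c) z = 0 := by rw [hev'.deriv_eq, deriv_const]
    have h1 : deriv (fun z'' : ℝ => fderiv ℝ (U (-1)) (Γ s + z'' • e2) u c) z = fderiv ℝ (fun y => fderiv ℝ (U (-1)) y u c) P e2 := hc.deriv
    rw [h0] at h1; exact h1.symm
  have hE1' : ∀ (u : EuclideanSpace ℝ (Fin 3)), u 2 = 0 → fderiv ℝ (fun y => fderiv ℝ (U (-1)) y u 2) P e2 = 0 := fun u hu =>
    hlineD u 2 (Filter.Eventually.of_forall fun z' => by rw [← hcoord]; exact hE1 s z' u hu)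
  have hE3' : fderiv ℝ (fun y => fderiv ℝ (U (-1)) y e2 b) P e2 = 0 := by
    refine hlineD e2 b ?_
    have hmem : Ioo (-ρ) ρ ∈ 𝓝 z := isOpen_Ioo.mem_nhds ⟨(abs_lt.1 hz).1, (abs_lt.1 hz).2⟩
    filter_upwards [hmem] with z' hz'
    exact hE3 s z' (abs_lt.2 ⟨hz'.1, hz'.2⟩) b hb
  refine ⟨?_, by rw [← he2]; exact hE3'⟩
  /- the harmonicity, component by component -/
  have hb01 : b = 0 ∨ b = 1 := by
    rcases b with ⟨i, hi⟩
    have hi2 : i ≠ 2 := fun h => hb (Fin.ext h)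
    rcases Nat.lt_succ_iff.1 hi |>.lt_or_eq with h | h
    · rcases Nat.lt_succ_iff.1 h |>.lt_or_eq with h' | h'
      · left; exact Fin.ext (Nat.lt_one_iff.1 h')
      · right; exact Fin.ext h'
    · exact absurd h hi2
  have hD02 : fderiv ℝ (fun y => fderiv ℝ (U (-1)) y e2 2) P e₀ = 0 := by rw [hsymm]; exact hE1' e₀ (by simp [he₀])
  have hD12 : fderiv ℝ (fun y => fderiv ℝ (U (-1)) y e2 2) P e₁ = 0 := by rw [hsymm]; exact hE1' e₁ (by simp [he₁])
  rcases hb01 with rfl | rfl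
  · -- `b = 0`: `∂₀²U₀ + ∂₁²U₀ = ∂₀(∂₀U₀ + ∂₁U₁) = −∂₀∂₂U₂ = 0`
    have h1 : fderiv ℝ (fun y => fderiv ℝ (U (-1)) y e₁ 0) P e₁ = fderiv ℝ (fun y => fderiv ℝ (U (-1)) y e₁ 1) P e₀ := by
      rw [← hcurlD e₁, hsymm]
    have h2 := hdivD e₀
    rw [hD02, add_zero] at h2
    rw [h1]; exact h2
  · -- `b = 1`: `∂₀²U₁ + ∂₁²U₁ = ∂₁(∂₀U₀ + ∂₁U₁) = −∂₁∂₂U₂ = 0`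
    have h1 : fderiv ℝ (fun y => fderiv ℝ (U (-1)) y e₀ 1) P e₀ = fderiv ℝ (fun y => fderiv ℝ (U (-1)) y e₀ 0) P e₁ := by
      rw [hcurlD e₀, hsymm]
    have h2 := hdivD e₁
    rw [hD12, add_zero] at h2
    rw [h1]; exact h2

end Summit.NavierStokesRegularity.NavierStokesRegularity.Theorems.PoloidalWindowDoorLrcModEntireQ4CurvedVerticalCurtainLines

end
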